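import Summits.BirchSwinnertonDyer.BirchSwinnertonDyer.Theorems.TeichmullerTwistDescentKOfBorelEigenfunctional
import Summits.BirchSwinnertonDyer.BirchSwinnertonDyer.Theorems.TeichmullerTwistDescentOrdinaryLowValuationOfSaturation
import Summits.BirchSwinnertonDyer.BirchSwinnertonDyer.Theorems.TeichmullerTwistDescentNeronLatticeTwistPStarOfLowValuation
import HarnessLib

/-!
# Route `TeichmullerTwistDescent`: GE11 `OrdinaryLowValuationOptimalManinUnitGeEleven` (stmt-BirchSwinnertonDyer-23885)
# from its FINAL named inputs — modularity, Edixhoven's Kodaira-type theorem, a nonzero Borel eigenfunctional on the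
# full-level carrier (I1‴) and the Ash–Stevens weight exclusion (W‴)

Cell `pub/bsd-wall` (D-0145 line route-BirchSwinnertonDyer-TeichmullerTwistDescent, OPEN rev 7), seat `bsd-line-ttd-p1`
(prover 1/2, g25).  THEOREMS ONLY; `--supports stmt-BirchSwinnertonDyer-25368`.  A CLOSURE CERTIFICATE, not a closing file:
BSD is not proved; GE11 / K are NOT proved (conditional); nothing here closes an item.  Supersedes the certificate
`TeichmullerTwistDescentGE11OfInputs` (inputs I1″/W″) by the weaker carrier-level inputs (I1‴) `NonzeroBorelEigenfunctional`
and (W‴) `NoEtaleWeightEigenQuotient` of `TeichmullerTwistDescentCarrierDefs` (both statements about the group homology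
`H₁(Γ₀(M), ℤ_p[GL₂(𝔽_p)])`, its `GL₂(𝔽_p)`-action and its Hecke operators `T_q`): the `p ≥ 11` potentially ordinary II/III/IV
optimal Manin statement GE11 (Edixhoven 1991 §4 «case 2») holds GRANTED modularity, Edixhoven 1991 Thm. 3 outside II/III/IV,
(I1‴) [the tame principal series occurs: local Langlands / Carayol at `p`] and (W‴) [`Sym^{2b} ⊗ det^{−b}` is not a weight of
`ρ̄_W`: Ash–Stevens + Deligne / Fontaine / Edixhoven weight minimality]. [cite: EdixhovenManin1991, §4 and Thm. 3]
[cite: Stevens1989, Lemma (5.2)] [cite: AshStevens1986, Thm. 3.5]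
-/

set_option autoImplicit false
-- single-conjunct summit: `Summit.BirchSwinnertonDyer.BirchSwinnertonDyer.…` repeats the name by design
set_option linter.dupNamespace false

noncomputable section

namespace Summit.BirchSwinnertonDyer.BirchSwinnertonDyer.Theorems.TeichmullerTwistDescent

open Literature.NumberTheory.EllipticCurves.ModularForms
open Summit.BirchSwinnertonDyer.BirchSwinnertonDyer.Theses.TeichmullerTwistDescent

namespace KOfBorelEigenfunctional

/-- **GE11 from its final named inputs.**  `OrdinaryLowValuationOptimalManinUnitGeEleven` (the route decl, verbatim) follows
from modularity, Edixhoven's Kodaira-type theorem, a nonzero Borel eigenfunctional on the full-level carrier (I1‴) and the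
Ash–Stevens weight exclusion (W‴), through K (`twistedPeriodLatticeSaturation_of_borel_of_noEtaleWeightEigenQuotient`), the
proved Néron twist lemma and the proved LINE 11 glue.  BSD is not proved by this; GE11 is proved CONDITIONALLY on the four
named hypotheses. [cite: EdixhovenManin1991, §4 and Thm. 3] [cite: Stevens1989, Lemma (5.2)] -/
theorem ordinaryLowValuationOptimalManinUnitGeEleven_of_borel_inputs (hnf : exists_isNewformOf)
    (hEdix : edixhoven_not_dvd_maninConstant_of_kodairaSymbol_ne)
    (hB : NonzeroBorelEigenfunctional) (hW : NoEtaleWeightEigenQuotient) :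
    OrdinaryLowValuationOptimalManinUnitGeEleven :=
  ordinaryLowValuationOfSaturation_proof
    (twistedPeriodLatticeSaturation_of_borel_of_noEtaleWeightEigenQuotient hnf hB hW)
    neronLatticeTwistPStarOfLowValuation_proof ⟨hEdix, hnf⟩

end KOfBorelEigenfunctional

end Summit.BirchSwinnertonDyer.BirchSwinnertonDyer.Theorems.TeichmullerTwistDescent
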